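import Summits.Ventures.WeilGRH.TwistedTwoPrimeChain
import HarnessLib

/-!
# Moment-method certificates for TWISTED Weil weights, IX: two-prime chain layer — `|γ|` bounds and the checker bridge

Cell `rh-explicit`, WEIL TRACK — GRH ARM (namespace `Summit.Ventures.WeilGRH`).  Continuation of
`TwistedTwoPrimeChain.lean` (the two-prime chain layer for an arbitrary even weight `W`): the sup bounds
`abs_cellsGamma₂₃_le_bndSumW` / `abs_cellsGamma₂₃_le_bndMaxW`, the `|γ|`-moment bound
`integral_abs_cellsGamma₂₃_mul_pow_leW` (proofs verbatim from `WeilTwoPrimeMinorant.lean`, `Valid ↦ CellValidW23`), and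
**`cellsOKW23_of_checkCellsZS23`**: the Boolean checker `checkCellsZS23 s₂ s₃ …` of `TwistedTwoPrimeCells.lean` yields
`CellsOKW23 wL T cells (twistWeight23 s₂ s₃)`.  Everything here is PROVED; no named facts.
-/

noncomputable section

open Complex Filter Set MeasureTheory
open scoped Real Topology

namespace Summit.Ventures.WeilGRH

open Literature.NumberTheory.LFunctions
open Literature.Analysis.ValidatedNumerics.Numerics
open Literature.Analysis.SpecialFunctions

/-! ## Sup bounds of `|γ|` -/

/-- `step(s) ≤ Σ_j bnd_j` (`W`-valid cells). [folklore] -/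
theorem stepAux₂₃_le_bndSumW {wL : ℚ} {cells : List TPDCell} {W : ℝ → ℝ} (hall : ∀ c ∈ cells, CellValidW23 c W)
    (s : ℝ) : stepAux₂₃ wL cells s ≤ (cellsBndSumQ₂₃ wL cells : ℝ) := by
  induction cells with
  | nil => simp [stepAux₂₃, cellsBndSumQ₂₃]
  | cons c cs ih =>
    simp only [stepAux₂₃, cellsBndSumQ₂₃]
    push_cast
    refine add_le_add ?_ (ih fun c' hc' ↦ hall c' (by simp [hc']))
    have hb0 : (0 : ℝ) ≤ ((c.bndQ wL : ℚ) : ℝ) := by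
      exact_mod_cast (hall c (by simp)).bndQ_nonneg wL
    by_cases hs : s ∈ Ico (c.fp.psi.u : ℝ) c.fp.psi.v
    · rw [Set.indicator_of_mem hs]
    · rw [Set.indicator_of_notMem hs]; exact hb0

/-- `0 ≤ Σ_j bnd_j`. [folklore] -/
theorem cellsBndSumQ₂₃_nonnegW {wL : ℚ} {cells : List TPDCell} {W : ℝ → ℝ} (hall : ∀ c ∈ cells, CellValidW23 c W) :
    (0 : ℝ) ≤ (cellsBndSumQ₂₃ wL cells : ℝ) :=
  le_trans ((stepAux₂₃_propsW (wL := wL) hall).1.choose_spec 0).1 (stepAux₂₃_le_bndSumW hall 0)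


section AbsMoments

variable {wL T : ℚ} {cells : List TPDCell} {W : ℝ → ℝ}

/-- `step` vanishes off `[s₀, T)` for a chain of valid cells from `s₀` to `T`. [folklore] -/
theorem stepAux₂₃_eq_zeroW {s₀ : ℚ} (hchain : checkChain₂₃ cells s₀ T = true)
    (hall : ∀ c ∈ cells, CellValidW23 c W) {x : ℝ} (hx : x < s₀ ∨ (T : ℝ) ≤ x) :
    stepAux₂₃ wL cells x = 0 := by
  induction cells generalizing s₀ with
  | nil => rfl
  | cons c cs ih =>
    have hb := chain_bounds₂₃W hchain hall
    simp only [checkChain₂₃, Bool.and_eq_true, decide_eq_true_eq] at hchain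
    have hcv : (c.fp.psi.v : ℝ) ≤ T := by exact_mod_cast (hb.2 c (by simp)).2
    have huv : (c.fp.psi.u : ℝ) < c.fp.psi.v := by exact_mod_cast (hall c (by simp)).u_lt_v
    have hus : (c.fp.psi.u : ℝ) = s₀ := by exact_mod_cast hchain.1
    simp only [stepAux₂₃]
    rw [ih hchain.2 (fun c' hc' ↦ hall c' (by simp [hc'])) ?_, add_zero, Set.indicator_of_notMem]
    · rintro ⟨h1, h2⟩
      rcases hx with hx | hx <;> linarith
    · rcases hx with hx | hx
      · left; linarith
      · right; exact hx

/-- `step(s) ≤ max_j bnd_j` for a chain (the cells are disjoint, so at most one term is live). [folklore] -/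
theorem stepAux₂₃_le_bndMaxW {s₀ : ℚ} (hchain : checkChain₂₃ cells s₀ T = true)
    (hall : ∀ c ∈ cells, CellValidW23 c W) (s : ℝ) :
    stepAux₂₃ wL cells s ≤ (cellsBndMaxQ₂₃ wL cells : ℝ) := by
  induction cells generalizing s₀ with
  | nil => simp [stepAux₂₃, cellsBndMaxQ₂₃]
  | cons c cs ih =>
    simp only [checkChain₂₃, Bool.and_eq_true, decide_eq_true_eq] at hchain
    have hall' : ∀ c' ∈ cs, CellValidW23 c' W := fun c' hc' ↦ hall c' (by simp [hc'])
    simp only [stepAux₂₃, cellsBndMaxQ₂₃]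
    push_cast
    by_cases hs : s ∈ Ico (c.fp.psi.u : ℝ) c.fp.psi.v
    · -- the live cell is `c`; the rest of the chain starts at `v > s`
      rw [Set.indicator_of_mem hs, stepAux₂₃_eq_zeroW hchain.2 hall' (Or.inl hs.2), add_zero]
      exact le_max_left _ _
    · rw [Set.indicator_of_notMem hs, zero_add]
      exact (ih hchain.2 hall').trans (le_max_right _ _)

/-- **Sup bound for the signed minorant.** `|γ(t)| ≤ Σ_j bnd_j` for all real `t`. [folklore] -/
theorem abs_cellsGamma₂₃_le_bndSumW (h : CellsOKW23 wL T cells W) (t : ℝ) :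
    |cellsGamma₂₃ wL cells t| ≤ (cellsBndSumQ₂₃ wL cells : ℝ) := by
  have hall := h.valid
  unfold cellsGamma₂₃
  exact (abs_gammaAux₂₃_le_stepW hall |t|).trans (stepAux₂₃_le_bndSumW hall |t|)

/-- **Sup bound for the signed minorant (sharp form).** `|γ(t)| ≤ max_j bnd_j`. [folklore] -/
theorem abs_cellsGamma₂₃_le_bndMaxW (h : CellsOKW23 wL T cells W) (t : ℝ) :
    |cellsGamma₂₃ wL cells t| ≤ (cellsBndMaxQ₂₃ wL cells : ℝ) := by
  unfold cellsGamma₂₃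
  exact (abs_gammaAux₂₃_le_stepW h.valid |t|).trans (stepAux₂₃_le_bndMaxW h.chain h.valid |t|)

/-- **`|γ|`-moments.** For even `q`, `t ↦ |γ(t)| t^q` is integrable and
`∫ |γ(t)| t^q dt ≤ 2 · cellsAbsMomentQ₂₃(q)`. [folklore] -/
theorem integral_abs_cellsGamma₂₃_mul_pow_leW (h : CellsOKW23 wL T cells W) {q : ℕ}
    (hq : Even q) :
    Integrable (fun t ↦ |cellsGamma₂₃ wL cells t| * t ^ q) ∧
      ∫ t, |cellsGamma₂₃ wL cells t| * t ^ q ≤ 2 * (cellsAbsMomentQ₂₃ wL cells q : ℝ) := by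
  have hchain := h.chain
  have hall := h.valid
  obtain ⟨hFi, -⟩ := integral_cellsGamma₂₃_mul_powW h hq
  obtain ⟨⟨B, hB⟩, hSm⟩ := stepAux₂₃_propsW (wL := wL) hall
  obtain ⟨-, hSv⟩ := integral_stepAux₂₃_mul_powW (wL := wL) hall q
  have hT0 : (0 : ℝ) ≤ T := by exact_mod_cast (chain_bounds₂₃W hchain hall).1
  have hev : (fun t ↦ |cellsGamma₂₃ wL cells t| * t ^ q) =
      fun t ↦ |cellsGamma₂₃ wL cells t * t ^ q| := by
    funext t; rw [abs_mul, abs_pow, hq.pow_abs]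
  have hint : Integrable (fun t ↦ |cellsGamma₂₃ wL cells t| * t ^ q) := by rw [hev]; exact hFi.abs
  refine ⟨hint, ?_⟩
  set G : ℝ → ℝ := fun s ↦ stepAux₂₃ wL cells s * s ^ q with hG
  have hG0 : ∀ s, s ∉ Ici (0 : ℝ) → G s = 0 := fun s hs ↦ by
    rw [hG]; simp only
    rw [stepAux₂₃_eq_zeroW hchain hall (Or.inl (by simpa using hs)), zero_mul]
  have hle : ∀ t, |cellsGamma₂₃ wL cells t| * t ^ q ≤ G |t| := by
    intro t
    rw [hG]; simp only
    rw [hq.pow_abs]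
    refine mul_le_mul_of_nonneg_right ?_ (by rw [← hq.pow_abs]; positivity)
    unfold cellsGamma₂₃
    exact abs_gammaAux₂₃_le_stepW hall |t|
  -- integrability of `G ∘ |·|`: bounded with support in `[-T, T]`
  have hB0 : 0 ≤ B := (hB 0).1.trans (hB 0).2
  have hmeas : Measurable fun t ↦ G |t| := by
    rw [hG]; exact (hSm.mul (measurable_id.pow_const q)).comp continuous_abs.measurable
  have hconst : IntegrableOn (fun _ : ℝ ↦ B * (T : ℝ) ^ q) (Icc (-(T : ℝ)) T) :=
    integrableOn_const measure_Icc_lt_top.ne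
  have hGi : Integrable fun t ↦ G |t| := by
    refine Integrable.mono' ((integrable_indicator_iff measurableSet_Icc).2 hconst)
      hmeas.aestronglyMeasurable (Eventually.of_forall fun t ↦ ?_)
    by_cases ht : |t| < T
    · have hmem : t ∈ Icc (-(T : ℝ)) T := ⟨by linarith [neg_abs_le t], by linarith [le_abs_self t]⟩
      rw [Set.indicator_of_mem hmem, hG, Real.norm_eq_abs]
      simp only
      rw [abs_mul, abs_pow, abs_abs, abs_of_nonneg (hB _).1]
      exact mul_le_mul (hB _).2 (pow_le_pow_left₀ (abs_nonneg t) ht.le q) (by positivity) hB0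
    · push Not at ht
      rw [hG, Real.norm_eq_abs]
      simp only
      rw [stepAux₂₃_eq_zeroW hchain hall (Or.inr ht), zero_mul, abs_zero]
      exact Set.indicator_nonneg (fun _ _ ↦ by positivity) _
  have hmono := integral_mono hint hGi hle
  refine hmono.trans (le_of_eq ?_)
  rw [integral_comp_abs (f := G), ← integral_Ici_eq_integral_Ioi,
    setIntegral_eq_integral_of_forall_compl_eq_zero hG0, hSv]

end AbsMoments
/-! ## From the Boolean checker of file VII -/

/-- **The valid chain from the twisted two-prime integer checker.** [folklore] -/
theorem cellsOKW23_of_checkCellsZS23 {s₂ s₃ : ℤ} {p j : ℕ} {wL T : ℚ} {M : ℕ} {cells : List TPDCell}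
    (h : checkCellsZS23 s₂ s₃ p j wL T M cells = true) : CellsOKW23 wL T cells (twistWeight23 s₂ s₃) := by
  obtain ⟨hchain, hall, -, -, -, -, -⟩ := checkCellsZS23_spec h
  have hchain' : checkChain₂₃ cells 0 T = true := by rw [checkChain₂₃_eq_map]; exact hchain
  have hvalid : ∀ c ∈ cells, CellValidW23 c (twistWeight23 s₂ s₃) :=
    fun c hc ↦ cellValidW23_of_checkZS23 (hall c hc)
  have hT0 : (0 : ℚ) ≤ T := (chain_bounds₂₃W hchain' hvalid).1
  exact ⟨hchain', hvalid, fun t ht ↦ checkCellsZS23_tail h hT0 ht⟩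

end Summit.Ventures.WeilGRH

end
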